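import Summits.QuantumFields.YangMills.Theorems.FluctuationComparisonRegPrIntLS2BetaWilsonActionChartDeriv
import Summits.QuantumFields.YangMills.Theorems.FluctuationComparisonRegPrIntLS2BetaMultiplierFormOfLocalMin
import Summits.QuantumFields.YangMills.Theorems.FluctuationComparisonRegPrIntLS2BetaArgminLocalMinOnFibre
import HarnessLib

/-!
# S2β · THE INSTANCE DOOR «CRIT-m♮ ⟸ (SUBM-m)» — constrained criticality of the argmin IN MULTIPLIER FORM from ONE remaining input: the charted descent is a strictly
# differentiable SUBMERSION at the argmin (composition BY NAME of ✓p822961 (α) Lagrange door, ✓p822751 (β) interior lemma, ✓(A-C¹) `…WilsonActionChartDeriv`)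

Cell `ym3-torus` (YM ladder rung R3 = continuum `SU(2)` Yang–Mills on the three-torus at fixed lattice data — a RUNG: NOT d = 4, NOT infinite volume, NOT a mass gap,
NOT Clay).  Width seat `ym3-torus-px5` (gen 22); crux `stmt-QuantumFields-20520` (`…Theses.UnitScaleTilt.FluctuationComparisonRegPrIntL`), LINE g18-1 S2β, organ GAP♯∘
(registered `stub_uniformFibreGapOrbit`, registry UNTOUCHED) ⟸ (D♮) ∧ (F♮) ⟸ «CRIT♮» ∧ (BKG)✓p822405 ⟸ «MULT♭» = CRIT-m♮ ∧ MULT♮ ∧ AVG₂♭ (px16 g21 (3)∕(5)); `--kind proof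
--supports stmt-QuantumFields-20520 --as helper`, count-neutral, DEFINITION-FREE (0 `def`, 0 `instance`, 0 `notation`, 0 `sorry`, default heartbeats).

THE ONE HYPOTHESIS, (SUBM-m) — per background `U₀` over the datum `V` (stride `J ≤ K`), in the right-invariant chart `ζ ↦ expPoint(ζ)•U₀` of px16 g21's (4)∕(5): a
«charted descent» `Mc : (PBond (F.P K) 0 → ℝ³) → Y` into ANY real Banach space `Y` (the (SUBM-m) typer's choice: e.g. a log-chart at `V` of `D_{J,K}(expPoint(ζ)•U₀)`), with
(s1) `HasStrictFDerivAt Mc DM 0`, (s2) `DM` ONTO, (s3) «level set ⊆ charted fibre near `0`»: `∃ N ∈ 𝓝 0, ∀ ζ ∈ N, Mc ζ = Mc 0 → expPoint(ζ)•U₀ ∈ fibre F ℰp J K _ V` (automatic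
when `Mc` is an injective chart of the descended field).  `DM` is then THE object RINV-cov (px16 g21) and AVG₂♭ (px10 g23) quantify; this file does not construct it.

WHAT IS PROVED (sorry-free).
* §1 ★★★`exists_multiplier_of_subm` — `IsLocalMinOn A (fibre …) U₀` (= ✓(β)'s conclusion) + (s1)(s2)(s3) ⟹ **`∃ lam : Y → ℝ, ∀ ζ, DA(U₀)[ζ] = lam (DM ζ)`** with `DA(U₀)`
  ✓p822511's explicit pairing — CRIT-m♮'s conjunct VERBATIM for that `DM`; ★★`fibreConst_of_subm` (the same in ✓(5) §2 `multiplier_of_rightInverse`'s hypothesis shape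
  «`DM ζ = DM ζ′ → DA ζ = DA ζ′`»); ★`firstVariation_eq_zero_of_subm` («`ker DM ≤ ker DA(U₀)`»).  Proof: ✓(A-C¹) `exists_hasStrictFDerivAt_wilsonAction4_chart` gives the strict
  derivative `D` of `A ∘ chart` at `0` with `D ζ = DA(U₀)[ζ]`; the chart is continuous with `chart 0 = U₀`, so ✓(α) `isLocalMinOn_comp_preimage` pulls the fibre-local
  minimum back, ✓(α) `isLocalMinOn_levelSet_of_inter_nhds_subset` + (s3) moves it to `Mc`'s level set, and ✓(α) `exists_fun_eq_comp_of_isLocalMinOn` (Mathlib Lagrange,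
  degenerate multiplier excluded by (s2)) concludes.
* §2 ★★★`exists_multiplier_of_subm_of_argmin` ∕ `fibreConst_of_subm_of_argmin` — the same with ✓(β) `isLocalMinOn_fibre_of_argmin` built in: under FILE D §1's hypotheses
  (Thm-1 pair at `(L, a₀, a₁, B₃)`, threshold profile `θ`), for an argmin good history `U₀` over `V` and (SUBM-m) data at `U₀`.

ASSEMBLY NOTE (for the «MULT♭» discharger).  «MULT♭» binds `∃ DM lam` over CRIT-m♮ ∧ MULT♮ ∧ AVG₂♭ jointly; take `DM := ⇑DM` from (SUBM-m), CRIT-m♮ from `fibreConst_of_subm`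
through ✓(5) §2 `multiplier_of_rightInverse` (so that `lam := DA∘R` is the SAME multiplier MULT♮ bounds via RINV-cov + ✓`abs_firstVariation_le_curl` + BKG ✓p822405), AVG₂♭ from
px10 g23 for the same `DM`.  The registry-prefix plumbing is ✓(β)∕✓BKG's `…_at` pattern once all three are in hand.

HONEST.  Composition BY NAME + continuity of the chart; nothing of Bałaban's analysis; (SUBM-m) is a HYPOTHESIS here; RINV-cov, AVG₂♭, MULT♮, «CRIT♮», (D♮)∕(F♮), GAP♯∘, the
five REGISTERED stubs, S2β, crux 20520, 19936, 19200 and `YM3TorusSU2` are NOT proved; no summit statement is proved by a helper; rung R3 = SU(2) YM₃ on T³ at fixed lattice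
data — NOT d = 4, NOT infinite volume, NOT a mass gap, NOT Clay; the Yang–Mills mass gap is NOT proved.  Axioms standard.

References: T. Bałaban, CMP **102** (1985) 277–309 [Balaban1985Variational] ((26) p.282, (171) p.305: criticality of the background under the average constraint, the printed
instance); CMP **102** (1985) 255–275 [Balaban1985UV3] (p.260 «has a minimum at A = 0 … a linear term in its expansion vanishes»); Mathlib `Analysis.Calculus.LagrangeMultipliers`.
-/

set_option autoImplicit false

noncomputable section

open scoped Quaternion RealInnerProductSpace Topology
open Filter
open Literature.MathematicalPhysics.QuantumLattice (su2Quat)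
open Literature.MathematicalPhysics.QuantumFieldTheory.Balaban1983to89
open Literature.MathematicalPhysics.QuantumFieldTheory.Balaban1983to89.T3ContinuumYM3Torus
open Literature.MathematicalPhysics.QuantumFieldTheory.Balaban1983to89.T3UnitLawDensityEML (ℰp)
open Literature.MathematicalPhysics.QuantumFieldTheory.Balaban1983to89.T3UnitScaleTilt
open Literature.MathematicalPhysics.QuantumFieldTheory.Balaban1983to89.T3TiltDescent
open Literature.MathematicalPhysics.QuantumFieldTheory.Balaban1983to89.T3ConstrainedMinimiser (fibre)
open Literature.MathematicalPhysics.QuantumFieldTheory.Balaban1983to89.T3DescentFibreTower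
open Literature.MathematicalPhysics.QuantumFieldTheory.Balaban1983to89.T3PrintedRegularMinimiser
open Literature.MathematicalPhysics.QuantumFieldTheory.Balaban1983to89.T3PrintedMinimiserExistence
open Literature.MathematicalPhysics.QuantumFieldTheory.Balaban1983to89.T3Thm1UniquenessSchema (Thm1UniqueMinOrbitAt)
open Literature.MathematicalPhysics.QuantumFieldTheory.Balaban1983to89.T4CubeChartGnomonic (SU2)
open Literature.MathematicalPhysics.QuantumFieldTheory.Balaban1983to89.T4HaarSU2ExpChart (expPoint expPoint_zero continuous_expPoint)
open Literature.MathematicalPhysics.QuantumFieldTheory.Balaban1983to89.T4ExpWindowSmallField (imVec)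
open Literature.MathematicalPhysics.QuantumFieldTheory.Balaban1983to89.B15Prop1ChartSU2 (adSU2)
open Literature.MathematicalPhysics.QuantumFieldTheory.Balaban1983to89.T4Continuum
open Summit.QuantumFields.YangMills.Theorems.FluctuationComparisonRegPrIntLS2BetaWilsonActionChartDeriv (exists_hasStrictFDerivAt_wilsonAction4_chart)
open Summit.QuantumFields.YangMills.Theorems.FluctuationComparisonRegPrIntLS2BetaMultiplierFormOfLocalMin
  (exists_fun_eq_comp_of_isLocalMinOn isLocalMinOn_levelSet_of_inter_nhds_subset isLocalMinOn_comp_preimage)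
open Summit.QuantumFields.YangMills.Theorems.FluctuationComparisonRegPrIntLS2BetaArgminLocalMinOnFibre (isLocalMinOn_fibre_of_argmin)
open GaugeField (plaqHol)

namespace Summit.QuantumFields.YangMills.Theorems.FluctuationComparisonRegPrIntLS2BetaCritMOfSubmersion

/-! ## §1 CRIT-m♮ from a fibre-local minimum and (SUBM-m) -/

section Door

variable {P : Params} {j : ℕ}

/-- The right-invariant chart `ζ ↦ expPoint(ζ)•U₀` is continuous. [folklore] -/
theorem continuous_chart (U₀ : GaugeField P j SU2) :
    Continuous (fun ζ : PBond P j → EuclideanSpace ℝ (Fin 3) => (fun ℓ => expPoint (ζ ℓ) * U₀ ℓ : GaugeField P j SU2)) :=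
  continuous_pi fun ℓ => (continuous_expPoint.comp (continuous_apply ℓ)).mul continuous_const

/-- The chart is based at `U₀`: `expPoint(0)•U₀ = U₀`. [folklore] -/
theorem chart_zero (U₀ : GaugeField P j SU2) :
    (fun ℓ => expPoint ((0 : PBond P j → EuclideanSpace ℝ (Fin 3)) ℓ) * U₀ ℓ : GaugeField P j SU2) = U₀ := by
  funext ℓ
  simp [expPoint_zero]

end Door

section Organ

variable {F : T3Family}

/-- ★★★ **CRIT-m♮ ⟸ (SUBM-m)**: if the background `U₀` is a local minimum of the Wilson action on the descent fibre of `V` (✓(β)), and `Mc` is a «charted descent» at `U₀`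
— strictly differentiable at `0` with ONTO derivative `DM`, whose level set through `0` lies in the charted fibre near `0` — then the first variation `DA(U₀)` (✓p822511's
pairing; a derivative by ✓(A-C¹)) FACTORS THROUGH `DM`: `∃ λ, ∀ ζ, DA(U₀)[ζ] = λ (DM ζ)`. [cite: Balaban1985Variational, (26) p.282, (171) p.305] -/
theorem exists_multiplier_of_subm {J K : ℕ} (hJK : J ≤ K) {V : GaugeField (F.P J) 0 SU2} (U₀ : GaugeField (F.P K) 0 SU2)
    (hloc : IsLocalMinOn (fun W : GaugeField (F.P K) 0 SU2 => wilsonAction4 W) (fibre F ℰp J K hJK V) U₀)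
    {Y : Type*} [NormedAddCommGroup Y] [NormedSpace ℝ Y] [CompleteSpace Y]
    {Mc : (PBond (F.P K) 0 → EuclideanSpace ℝ (Fin 3)) → Y} {DM : (PBond (F.P K) 0 → EuclideanSpace ℝ (Fin 3)) →L[ℝ] Y}
    (hMc : HasStrictFDerivAt Mc DM 0) (hsurj : Function.Surjective DM)
    (hfib : ∃ N ∈ 𝓝 (0 : PBond (F.P K) 0 → EuclideanSpace ℝ (Fin 3)), ∀ ζ ∈ N, Mc ζ = Mc 0 →
      (fun ℓ => expPoint (ζ ℓ) * U₀ ℓ : GaugeField (F.P K) 0 SU2) ∈ fibre F ℰp J K hJK V) :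
    ∃ lam : Y → ℝ, ∀ ζ : PBond (F.P K) 0 → EuclideanSpace ℝ (Fin 3),
      (∑ p : Plaq (F.P K) 0, inner ℝ (imVec (su2Quat (GaugeField.plaqHol U₀ p)))
        (adSU2 (GaugeField.plaqHol U₀ p)⁻¹ (ζ ⟨p.src, p.μ⟩) + adSU2 ((GaugeField.plaqHol U₀ p)⁻¹ * U₀ ⟨p.src, p.μ⟩) (ζ ⟨p.src.shift p.μ, p.ν⟩) -
          adSU2 ((GaugeField.plaqHol U₀ p)⁻¹ * U₀ ⟨p.src, p.μ⟩ * U₀ ⟨p.src.shift p.μ, p.ν⟩ * (U₀ ⟨p.src.shift p.ν, p.μ⟩)⁻¹) (ζ ⟨p.src.shift p.ν, p.μ⟩) -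
          ζ ⟨p.src, p.ν⟩)) = lam (DM ζ) := by
  obtain ⟨D, hD, hDval⟩ := exists_hasStrictFDerivAt_wilsonAction4_chart U₀
  -- pull the fibre-local minimum back along the chart
  have hloc' : IsLocalMinOn (fun W : GaugeField (F.P K) 0 SU2 => wilsonAction4 W) (fibre F ℰp J K hJK V)
      ((fun ζ : PBond (F.P K) 0 → EuclideanSpace ℝ (Fin 3) => (fun ℓ => expPoint (ζ ℓ) * U₀ ℓ : GaugeField (F.P K) 0 SU2)) 0) := by
    have h0 := chart_zero U₀
    simp only at h0 ⊢
    rw [h0]; exact hloc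
  have hpre := isLocalMinOn_comp_preimage hloc' ((continuous_chart U₀).continuousAt.continuousWithinAt)
  -- move to the level set of the charted descent
  obtain ⟨N, hN, hsub⟩ := hfib
  have hlevel : IsLocalMinOn ((fun W : GaugeField (F.P K) 0 SU2 => wilsonAction4 W) ∘
      (fun ζ : PBond (F.P K) 0 → EuclideanSpace ℝ (Fin 3) => (fun ℓ => expPoint (ζ ℓ) * U₀ ℓ : GaugeField (F.P K) 0 SU2))) {ζ | Mc ζ = Mc 0} 0 :=
    isLocalMinOn_levelSet_of_inter_nhds_subset hpre hN (fun ζ hζ => hsub ζ hζ.2 hζ.1)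
  -- Lagrange (submersion case)
  obtain ⟨lam, hlam⟩ := exists_fun_eq_comp_of_isLocalMinOn hlevel hMc hD hsurj
  exact ⟨lam, fun ζ => by rw [← hDval ζ]; exact hlam ζ⟩

/-- ★★ **FIBRE-CONSTANCY SHAPE** (✓(5) §2 `multiplier_of_rightInverse`'s `hcrit`): under the same hypotheses `DM ζ = DM ζ′ → DA(U₀)[ζ] = DA(U₀)[ζ′]`.
[cite: Balaban1985Variational, (26) p.282, (171) p.305] -/
theorem fibreConst_of_subm {J K : ℕ} (hJK : J ≤ K) {V : GaugeField (F.P J) 0 SU2} (U₀ : GaugeField (F.P K) 0 SU2)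
    (hloc : IsLocalMinOn (fun W : GaugeField (F.P K) 0 SU2 => wilsonAction4 W) (fibre F ℰp J K hJK V) U₀)
    {Y : Type*} [NormedAddCommGroup Y] [NormedSpace ℝ Y] [CompleteSpace Y]
    {Mc : (PBond (F.P K) 0 → EuclideanSpace ℝ (Fin 3)) → Y} {DM : (PBond (F.P K) 0 → EuclideanSpace ℝ (Fin 3)) →L[ℝ] Y}
    (hMc : HasStrictFDerivAt Mc DM 0) (hsurj : Function.Surjective DM)
    (hfib : ∃ N ∈ 𝓝 (0 : PBond (F.P K) 0 → EuclideanSpace ℝ (Fin 3)), ∀ ζ ∈ N, Mc ζ = Mc 0 →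
      (fun ℓ => expPoint (ζ ℓ) * U₀ ℓ : GaugeField (F.P K) 0 SU2) ∈ fibre F ℰp J K hJK V)
    {ζ ζ' : PBond (F.P K) 0 → EuclideanSpace ℝ (Fin 3)} (hζ : DM ζ = DM ζ') :
    (∑ p : Plaq (F.P K) 0, inner ℝ (imVec (su2Quat (GaugeField.plaqHol U₀ p)))
        (adSU2 (GaugeField.plaqHol U₀ p)⁻¹ (ζ ⟨p.src, p.μ⟩) + adSU2 ((GaugeField.plaqHol U₀ p)⁻¹ * U₀ ⟨p.src, p.μ⟩) (ζ ⟨p.src.shift p.μ, p.ν⟩) -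
          adSU2 ((GaugeField.plaqHol U₀ p)⁻¹ * U₀ ⟨p.src, p.μ⟩ * U₀ ⟨p.src.shift p.μ, p.ν⟩ * (U₀ ⟨p.src.shift p.ν, p.μ⟩)⁻¹) (ζ ⟨p.src.shift p.ν, p.μ⟩) -
          ζ ⟨p.src, p.ν⟩)) =
      ∑ p : Plaq (F.P K) 0, inner ℝ (imVec (su2Quat (GaugeField.plaqHol U₀ p)))
        (adSU2 (GaugeField.plaqHol U₀ p)⁻¹ (ζ' ⟨p.src, p.μ⟩) + adSU2 ((GaugeField.plaqHol U₀ p)⁻¹ * U₀ ⟨p.src, p.μ⟩) (ζ' ⟨p.src.shift p.μ, p.ν⟩) -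
          adSU2 ((GaugeField.plaqHol U₀ p)⁻¹ * U₀ ⟨p.src, p.μ⟩ * U₀ ⟨p.src.shift p.μ, p.ν⟩ * (U₀ ⟨p.src.shift p.ν, p.μ⟩)⁻¹) (ζ' ⟨p.src.shift p.ν, p.μ⟩) -
          ζ' ⟨p.src, p.ν⟩) := by
  obtain ⟨lam, hlam⟩ := exists_multiplier_of_subm hJK U₀ hloc hMc hsurj hfib
  rw [hlam ζ, hlam ζ', hζ]

/-- ★ **KERNEL SHAPE** («`ker DM ≤ ker DA(U₀)`»: the first variation vanishes on every tangent of the charted fibre). [cite: Balaban1985Variational, (26) p.282, (171) p.305] -/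
theorem firstVariation_eq_zero_of_subm {J K : ℕ} (hJK : J ≤ K) {V : GaugeField (F.P J) 0 SU2} (U₀ : GaugeField (F.P K) 0 SU2)
    (hloc : IsLocalMinOn (fun W : GaugeField (F.P K) 0 SU2 => wilsonAction4 W) (fibre F ℰp J K hJK V) U₀)
    {Y : Type*} [NormedAddCommGroup Y] [NormedSpace ℝ Y] [CompleteSpace Y]
    {Mc : (PBond (F.P K) 0 → EuclideanSpace ℝ (Fin 3)) → Y} {DM : (PBond (F.P K) 0 → EuclideanSpace ℝ (Fin 3)) →L[ℝ] Y}
    (hMc : HasStrictFDerivAt Mc DM 0) (hsurj : Function.Surjective DM)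
    (hfib : ∃ N ∈ 𝓝 (0 : PBond (F.P K) 0 → EuclideanSpace ℝ (Fin 3)), ∀ ζ ∈ N, Mc ζ = Mc 0 →
      (fun ℓ => expPoint (ζ ℓ) * U₀ ℓ : GaugeField (F.P K) 0 SU2) ∈ fibre F ℰp J K hJK V)
    {ζ : PBond (F.P K) 0 → EuclideanSpace ℝ (Fin 3)} (hζ : DM ζ = 0) :
    (∑ p : Plaq (F.P K) 0, inner ℝ (imVec (su2Quat (GaugeField.plaqHol U₀ p)))
        (adSU2 (GaugeField.plaqHol U₀ p)⁻¹ (ζ ⟨p.src, p.μ⟩) + adSU2 ((GaugeField.plaqHol U₀ p)⁻¹ * U₀ ⟨p.src, p.μ⟩) (ζ ⟨p.src.shift p.μ, p.ν⟩) -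
          adSU2 ((GaugeField.plaqHol U₀ p)⁻¹ * U₀ ⟨p.src, p.μ⟩ * U₀ ⟨p.src.shift p.μ, p.ν⟩ * (U₀ ⟨p.src.shift p.ν, p.μ⟩)⁻¹) (ζ ⟨p.src.shift p.ν, p.μ⟩) -
          ζ ⟨p.src, p.ν⟩)) = 0 := by
  have h := fibreConst_of_subm hJK U₀ hloc hMc hsurj hfib (ζ := ζ) (ζ' := 0) (by rw [hζ, map_zero])
  rw [h]
  simp

end Organ

/-! ## §2 The same for argmin good histories (✓(β) built in) -/

section Argmin

variable {F : T3Family}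

/-- ★★★ **CRIT-m♮ ⟸ (SUBM-m) AT AN ARGMIN GOOD HISTORY**: under FILE D §1's hypotheses (the Thm-1 pair at `(L, a₀, a₁, B₃)`, threshold profile `θ`), for a good history
`U₀` over `V` with `A(U₀) = minActionRegPr F J K ε₀ V` and (SUBM-m) data at `U₀`: `∃ λ, ∀ ζ, DA(U₀)[ζ] = λ (DM ζ)` (✓(β) `isLocalMinOn_fibre_of_argmin` ∘ §1).
[cite: Balaban1985Variational, Thm 1 (8)-(10) p.279, (26) p.282, (171) p.305] -/
theorem exists_multiplier_of_subm_of_argmin {L : ℕ} {a₀ a₁ B₃ : ℝ} (hT : Thm1GlobalMinAt L a₀ a₁ B₃) (hU1 : Thm1UniqueMinOrbitAt L a₀ a₁ B₃)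
    (hB₃ : 0 < B₃) (hFL : F.L = L) {ε₀ : ℝ} (hε₀ : 0 < ε₀) (hε₀a : ε₀ ≤ a₀) {θ : ℕ → ℝ} (hθpos : ∀ i, 0 < θ i)
    (hθa : ∀ i, θ i ≤ a₁) (hθB : ∀ i, B₃ * θ i * (F.L : ℝ) ^ 3 ≤ ε₀) (hθ4 : ∀ i, 4 * θ i * (F.L : ℝ) ^ 3 < ε₀)
    {J K : ℕ} (hJK : J ≤ K) {V : GaugeField (F.P J) 0 (Matrix.specialUnitaryGroup (Fin 2) ℂ)}
    {U₀ : GaugeField (F.P K) 0 (Matrix.specialUnitaryGroup (Fin 2) ℂ)} (hUf : U₀ ∈ fibre F ℰp J K hJK V) (hUg : U₀ ∈ histGood F ℰp θ K J)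
    (hA : wilsonAction4 U₀ = minActionRegPr F J K hJK ε₀ V)
    {Y : Type*} [NormedAddCommGroup Y] [NormedSpace ℝ Y] [CompleteSpace Y]
    {Mc : (PBond (F.P K) 0 → EuclideanSpace ℝ (Fin 3)) → Y} {DM : (PBond (F.P K) 0 → EuclideanSpace ℝ (Fin 3)) →L[ℝ] Y}
    (hMc : HasStrictFDerivAt Mc DM 0) (hsurj : Function.Surjective DM)
    (hfib : ∃ N ∈ 𝓝 (0 : PBond (F.P K) 0 → EuclideanSpace ℝ (Fin 3)), ∀ ζ ∈ N, Mc ζ = Mc 0 →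
      (fun ℓ => expPoint (ζ ℓ) * U₀ ℓ : GaugeField (F.P K) 0 SU2) ∈ fibre F ℰp J K hJK V) :
    ∃ lam : Y → ℝ, ∀ ζ : PBond (F.P K) 0 → EuclideanSpace ℝ (Fin 3),
      (∑ p : Plaq (F.P K) 0, inner ℝ (imVec (su2Quat (GaugeField.plaqHol U₀ p)))
        (adSU2 (GaugeField.plaqHol U₀ p)⁻¹ (ζ ⟨p.src, p.μ⟩) + adSU2 ((GaugeField.plaqHol U₀ p)⁻¹ * U₀ ⟨p.src, p.μ⟩) (ζ ⟨p.src.shift p.μ, p.ν⟩) -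
          adSU2 ((GaugeField.plaqHol U₀ p)⁻¹ * U₀ ⟨p.src, p.μ⟩ * U₀ ⟨p.src.shift p.μ, p.ν⟩ * (U₀ ⟨p.src.shift p.ν, p.μ⟩)⁻¹) (ζ ⟨p.src.shift p.ν, p.μ⟩) -
          ζ ⟨p.src, p.ν⟩)) = lam (DM ζ) :=
  exists_multiplier_of_subm hJK U₀ (isLocalMinOn_fibre_of_argmin hT hU1 hB₃ hFL hε₀ hε₀a hθpos hθa hθB hθ4 hJK hUf hUg hA) hMc hsurj hfib

/-- ★★ The fibre-constancy shape at an argmin good history. [cite: Balaban1985Variational, Thm 1 (8)-(10) p.279, (171) p.305] -/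
theorem fibreConst_of_subm_of_argmin {L : ℕ} {a₀ a₁ B₃ : ℝ} (hT : Thm1GlobalMinAt L a₀ a₁ B₃) (hU1 : Thm1UniqueMinOrbitAt L a₀ a₁ B₃)
    (hB₃ : 0 < B₃) (hFL : F.L = L) {ε₀ : ℝ} (hε₀ : 0 < ε₀) (hε₀a : ε₀ ≤ a₀) {θ : ℕ → ℝ} (hθpos : ∀ i, 0 < θ i)
    (hθa : ∀ i, θ i ≤ a₁) (hθB : ∀ i, B₃ * θ i * (F.L : ℝ) ^ 3 ≤ ε₀) (hθ4 : ∀ i, 4 * θ i * (F.L : ℝ) ^ 3 < ε₀)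
    {J K : ℕ} (hJK : J ≤ K) {V : GaugeField (F.P J) 0 (Matrix.specialUnitaryGroup (Fin 2) ℂ)}
    {U₀ : GaugeField (F.P K) 0 (Matrix.specialUnitaryGroup (Fin 2) ℂ)} (hUf : U₀ ∈ fibre F ℰp J K hJK V) (hUg : U₀ ∈ histGood F ℰp θ K J)
    (hA : wilsonAction4 U₀ = minActionRegPr F J K hJK ε₀ V)
    {Y : Type*} [NormedAddCommGroup Y] [NormedSpace ℝ Y] [CompleteSpace Y]
    {Mc : (PBond (F.P K) 0 → EuclideanSpace ℝ (Fin 3)) → Y} {DM : (PBond (F.P K) 0 → EuclideanSpace ℝ (Fin 3)) →L[ℝ] Y}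
    (hMc : HasStrictFDerivAt Mc DM 0) (hsurj : Function.Surjective DM)
    (hfib : ∃ N ∈ 𝓝 (0 : PBond (F.P K) 0 → EuclideanSpace ℝ (Fin 3)), ∀ ζ ∈ N, Mc ζ = Mc 0 →
      (fun ℓ => expPoint (ζ ℓ) * U₀ ℓ : GaugeField (F.P K) 0 SU2) ∈ fibre F ℰp J K hJK V)
    {ζ ζ' : PBond (F.P K) 0 → EuclideanSpace ℝ (Fin 3)} (hζ : DM ζ = DM ζ') :
    (∑ p : Plaq (F.P K) 0, inner ℝ (imVec (su2Quat (GaugeField.plaqHol U₀ p)))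
        (adSU2 (GaugeField.plaqHol U₀ p)⁻¹ (ζ ⟨p.src, p.μ⟩) + adSU2 ((GaugeField.plaqHol U₀ p)⁻¹ * U₀ ⟨p.src, p.μ⟩) (ζ ⟨p.src.shift p.μ, p.ν⟩) -
          adSU2 ((GaugeField.plaqHol U₀ p)⁻¹ * U₀ ⟨p.src, p.μ⟩ * U₀ ⟨p.src.shift p.μ, p.ν⟩ * (U₀ ⟨p.src.shift p.ν, p.μ⟩)⁻¹) (ζ ⟨p.src.shift p.ν, p.μ⟩) -
          ζ ⟨p.src, p.ν⟩)) =
      ∑ p : Plaq (F.P K) 0, inner ℝ (imVec (su2Quat (GaugeField.plaqHol U₀ p)))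
        (adSU2 (GaugeField.plaqHol U₀ p)⁻¹ (ζ' ⟨p.src, p.μ⟩) + adSU2 ((GaugeField.plaqHol U₀ p)⁻¹ * U₀ ⟨p.src, p.μ⟩) (ζ' ⟨p.src.shift p.μ, p.ν⟩) -
          adSU2 ((GaugeField.plaqHol U₀ p)⁻¹ * U₀ ⟨p.src, p.μ⟩ * U₀ ⟨p.src.shift p.μ, p.ν⟩ * (U₀ ⟨p.src.shift p.ν, p.μ⟩)⁻¹) (ζ' ⟨p.src.shift p.ν, p.μ⟩) -
          ζ' ⟨p.src, p.ν⟩) :=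
  fibreConst_of_subm hJK U₀ (isLocalMinOn_fibre_of_argmin hT hU1 hB₃ hFL hε₀ hε₀a hθpos hθa hθB hθ4 hJK hUf hUg hA) hMc hsurj hfib hζ

end Argmin

end Summit.QuantumFields.YangMills.Theorems.FluctuationComparisonRegPrIntLS2BetaCritMOfSubmersion

end
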